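import Mathlib
import Summits.ValiantsHypothesis.ValiantsHypothesis.Theorems.LiouvilleSarnakAlignedTypeICharactersMod2nParseval
import HarnessLib

/-!
# Route LiouvilleSarnak — support `AlignedTypeI` (stmt-ValiantsHypothesis-21040), line `characters_mod_2n`:
# the line has ONE stub — `KMTVariance → TwistedLiouvilleSmall`, and the stub as a full character mean square

State of the registered line `Cruxes/AlignedTypeI/Lines/characters_mod_2n.lean` after the files
`…CharactersMod2n{Defs,Assembly,KMTVariance,TwistedLiouville,KMTOnly,Parseval,KMTVarianceGreenRange,TopLevels,
TwistedLiouvilleLinear}.lean`: `stub_assembly` is landed, `alignedTypeI_of_KMTVariance` shows the second stub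
`stub_twistedLiouvilleSmall` is IDLE for the crux, and the crux is closed modulo the one named fact
`KMT2023_theorem13_liouville_twoPower`.  This file continues the structural bookkeeping of the line:

* §2 `twistedLiouvilleSmall_of_kmtVariance : KMTVariance → TwistedLiouvilleSmall` — the second registered stub is not
  merely idle but IMPLIED by the first (so the line has exactly one stub of content).  At a level `k ≥ k₀` with KMT
  character `χ`: for `ψ ≠ χ` the twisted sum is one term of the character mean square `φ(2^k) · variance`
  (`variance_eq_charMeanSquare`); for `ψ = χ` the dichotomy of `…KMTOnly.lean` (`χ² ≠ 1`: the variance bound itself,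
  `twisted_le_of_variance_of_sq_ne_one`; `χ² = 1`: Green's range, `twisted_le_of_sq_eq_one`); levels `k < k₀` are the
  tree's unconditional Green range `twisted_norm_le_of_level_le`.
* §3 `KMTVariance` is EQUIVALENT to the FULL character mean square with no character removed,
  `Σ_{ψ mod 2^k} |Σ_{m ≤ 2^(n+k)} λ(m) ψ(m)|² ≤ ε 4^(n+k)` for `k₀ ≤ k ≤ n`, `n ≥ n₀`
  (`kmtVariance_iff_charMeanSquareAll`): for `λ` and `2`-power moduli the exceptional character of KMT Thm 1.3 plays
  no role (complex `χ`: its own twisted sum is forced small by the variance; real `χ`: conductor `∣ 8`, prime number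
  theorem in progressions) — compare `charMeanSquare_of_kmtVariance` of `…Parseval.lean`, which keeps it.

§1 collects the small currencies used here and in the companion `…CharactersMod2nCharacterFree.lean` (the stub in
character-free `ℓ²` / `ℓ¹` form).

HONEST FRAMING.  Pure bookkeeping between the line's registered propositions; nothing cite-grade is discharged, no
stub is closed by name, `AlignedTypeI` is NOT closed (its residual is unchanged: Klurman–Mangerel–Teräväinen 2023
Thm 1.3 for `λ` and `2`-power moduli `≍ √x`), and nothing here bears on `VP ≠ VNP` (NOT proved).
-/

set_option linter.dupNamespace false

noncomputable section

namespace Summit.ValiantsHypothesis.ValiantsHypothesis.Theorems.LiouvilleSarnak.AlignedTypeI.CharactersModTwoN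

open ArithmeticFunction Finset
open scoped BigOperators

/-! ## §1 Elementary inequalities and currencies -/

/-- The one-character main term has total mass `‖W‖² / φ(2^k)` over the units:
`Σ_{u ∈ (ℤ/2^k)ˣ} ‖χ(u) W / φ‖² = ‖W‖² / φ`. [folklore] -/
theorem sum_units_norm_mainTerm_sq {k : ℕ} (χ : DirichletCharacter ℂ (2 ^ k)) (W : ℂ) :
    ∑ u : (ZMod (2 ^ k))ˣ, ‖χ (u : ZMod (2 ^ k)) / (Nat.totient (2 ^ k) : ℂ) * W‖ ^ 2 =
      ‖W‖ ^ 2 / (Nat.totient (2 ^ k) : ℝ) := by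
  haveI : NeZero (2 ^ k) := ⟨pow_ne_zero _ two_ne_zero⟩
  have hφ0 : (0 : ℝ) < (Nat.totient (2 ^ k) : ℝ) := by exact_mod_cast Nat.totient_pos.mpr (pow_pos two_pos k)
  have hterm : ∀ u : (ZMod (2 ^ k))ˣ,
      ‖χ (u : ZMod (2 ^ k)) / (Nat.totient (2 ^ k) : ℂ) * W‖ ^ 2 = ‖W‖ ^ 2 / (Nat.totient (2 ^ k) : ℝ) ^ 2 := by
    intro u
    rw [norm_mul, norm_div, χ.unit_norm_eq_one u, Complex.norm_natCast]
    field_simp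
  simp_rw [hterm]
  rw [Finset.sum_const, Finset.card_univ, ZMod.card_units_eq_totient, nsmul_eq_mul]
  field_simp

/-- Conjugating the character does not change the size of a twisted Liouville sum (`λ` is real). [folklore] -/
theorem norm_twistedSum_star (n k : ℕ) (χ : DirichletCharacter ℂ (2 ^ k)) :
    ‖∑ m : Fin (2 ^ (n + k)), ((liouville ((m : ℕ) + 1) : ℤ) : ℂ) * star (χ (((m : ℕ) + 1 : ℕ) : ZMod (2 ^ k)))‖ =
      ‖∑ m : Fin (2 ^ (n + k)), ((liouville ((m : ℕ) + 1) : ℤ) : ℂ) * χ (((m : ℕ) + 1 : ℕ) : ZMod (2 ^ k))‖ := by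
  rw [← norm_star, star_sum]
  congr 1
  refine Finset.sum_congr rfl fun m _ => ?_
  rw [star_mul', star_star, Complex.star_def, map_intCast]

/-- The class sum of the line as a complex number has norm the absolute value of the real class sum. [folklore] -/
theorem norm_classSum_cast (n k : ℕ) (u : (ZMod (2 ^ k))ˣ) :
    ‖(∑ b : Fin (2 ^ n), ((liouville ((u : ZMod (2 ^ k)).val + 2 ^ k * (b : ℕ)) : ℤ) : ℂ))‖ =
      |∑ b : Fin (2 ^ n), ((liouville ((u : ZMod (2 ^ k)).val + 2 ^ k * (b : ℕ)) : ℤ) : ℝ)| := by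
  have h : (∑ b : Fin (2 ^ n), ((liouville ((u : ZMod (2 ^ k)).val + 2 ^ k * (b : ℕ)) : ℤ) : ℂ)) =
      ((∑ b : Fin (2 ^ n), ((liouville ((u : ZMod (2 ^ k)).val + 2 ^ k * (b : ℕ)) : ℤ) : ℝ) : ℝ) : ℂ) := by
    push_cast
    rfl
  rw [h, Complex.norm_real, Real.norm_eq_abs]

/-- The real class sum of the line is the cast of `classSum n k u`. [folklore] -/
theorem classSum_cast_eq (n k : ℕ) (u : (ZMod (2 ^ k))ˣ) :
    (∑ b : Fin (2 ^ n), ((liouville ((u : ZMod (2 ^ k)).val + 2 ^ k * (b : ℕ)) : ℤ) : ℝ)) =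
      ((classSum n k (u : ZMod (2 ^ k)).val : ℤ) : ℝ) := by
  unfold classSum
  push_cast
  rfl

/-- Trivial bound for the real class sum: `|Σ_{b<2^n} λ(u + 2^k b)| ≤ 2^n`. [folklore] -/
theorem abs_classSum_cast_le (n k : ℕ) (u : (ZMod (2 ^ k))ˣ) :
    |∑ b : Fin (2 ^ n), ((liouville ((u : ZMod (2 ^ k)).val + 2 ^ k * (b : ℕ)) : ℤ) : ℝ)| ≤ 2 ^ n := by
  rw [classSum_cast_eq, ← Int.cast_abs]
  exact_mod_cast abs_classSum_le n k (u : ZMod (2 ^ k)).val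

/-- `φ(2^k) = 2^(k-1)` as a real number, for `k ≥ 1`. [folklore] -/
theorem totient_two_pow_cast {k : ℕ} (hk : 1 ≤ k) : (Nat.totient (2 ^ k) : ℝ) = 2 ^ (k - 1) := by
  rw [Nat.totient_prime_pow Nat.prime_two hk]
  push_cast
  ring

/-! ## §2 The second stub follows from the first -/

/-- **`KMTVariance → TwistedLiouvilleSmall`**: the line's second registered stub is implied by its first.  For
`ε > 0` take the KMT data at `η = ε²` (levels `k ≥ max k₀ 1`), the real-character bound `twisted_le_of_sq_eq_one ε`
and the Green range `twisted_norm_le_of_level_le (max k₀ 1) ε`.  At a level `k ≥ max k₀ 1` with KMT character `χ`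
and variance `V ≤ η 2^k 4^n`: if `ψ = χ` and `χ² ≠ 1`, `‖Σ λχ‖ ≤ ε 2^(n+k)` by `twisted_le_of_variance_of_sq_ne_one`;
if `ψ = χ` and `χ² = 1`, by the real-character bound; if `ψ ≠ χ`, `‖Σ λψ‖² ≤ φ(2^k) V ≤ η 2^(k-1) 2^k 4^n ≤ (ε 2^(n+k))²`
by `variance_eq_charMeanSquare`.  Levels `k < max k₀ 1` are the Green range. [folklore] -/
theorem twistedLiouvilleSmall_of_kmtVariance (hK : KMTVariance) : TwistedLiouvilleSmall := by
  intro ε hε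
  set η : ℝ := ε ^ 2 with hη
  have hη0 : 0 < η := by positivity
  obtain ⟨k₀, n₁, hV⟩ := hK η hη0
  obtain ⟨n₂, hR⟩ := twisted_le_of_sq_eq_one hε
  obtain ⟨n₃, hG⟩ := twisted_norm_le_of_level_le (max k₀ 1) ε hε
  refine ⟨max n₁ (max n₂ n₃), fun n hn k hkn ψ => ?_⟩
  have hn1 : n₁ ≤ n := le_trans (le_max_left _ _) hn
  have hn2 : n₂ ≤ n := le_trans ((le_max_left _ _).trans (le_max_right _ _)) hn
  have hn3 : n₃ ≤ n := le_trans ((le_max_right _ _).trans (le_max_right _ _)) hn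
  by_cases hk : max k₀ 1 ≤ k
  · have hk1 : 1 ≤ k := le_trans (le_max_right _ _) hk
    obtain ⟨χ, hχ⟩ := hV n hn1 k ((le_max_left _ _).trans hk) hkn
    haveI : NeZero (2 ^ k) := ⟨pow_ne_zero _ two_ne_zero⟩
    by_cases hψχ : ψ = χ
    · rw [hψχ]
      by_cases hsq : χ ^ 2 = 1
      · exact hR n hn2 k hk1 χ hsq
      · refine twisted_le_of_variance_of_sq_ne_one hk1 hε.le χ hsq ?_
        rw [← hη]
        exact hχ
    · -- `ψ ≠ χ`: one term of the character mean square
      have hms := hχ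
      rw [variance_eq_charMeanSquare n k hk1 χ] at hms
      have hφ := totient_two_pow_cast hk1
      have hφ0 : (0 : ℝ) < Nat.totient (2 ^ k) := by rw [hφ]; positivity
      rw [inv_mul_le_iff₀ hφ0, hφ] at hms
      have hmem : ψ ∈ (Finset.univ : Finset (DirichletCharacter ℂ (2 ^ k))).erase χ :=
        Finset.mem_erase.mpr ⟨hψχ, Finset.mem_univ _⟩
      have hsingle :
          ‖∑ m : Fin (2 ^ (n + k)), ((liouville ((m : ℕ) + 1) : ℤ) : ℂ) * ψ (((m : ℕ) + 1 : ℕ) : ZMod (2 ^ k))‖ ^ 2 ≤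
            ∑ ψ' ∈ (Finset.univ : Finset (DirichletCharacter ℂ (2 ^ k))).erase χ,
              ‖∑ m : Fin (2 ^ (n + k)), ((liouville ((m : ℕ) + 1) : ℤ) : ℂ) *
                  ψ' (((m : ℕ) + 1 : ℕ) : ZMod (2 ^ k))‖ ^ 2 :=
        Finset.single_le_sum (f := fun ψ' : DirichletCharacter ℂ (2 ^ k) =>
          ‖∑ m : Fin (2 ^ (n + k)), ((liouville ((m : ℕ) + 1) : ℤ) : ℂ) *
              ψ' (((m : ℕ) + 1 : ℕ) : ZMod (2 ^ k))‖ ^ 2) (fun _ _ => by positivity) hmem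
      have h2k : (2 : ℝ) ^ k = 2 * 2 ^ (k - 1) := by rw [← pow_succ', Nat.sub_add_cancel hk1]
      have hB : ‖∑ m : Fin (2 ^ (n + k)), ((liouville ((m : ℕ) + 1) : ℤ) : ℂ) *
          ψ (((m : ℕ) + 1 : ℕ) : ZMod (2 ^ k))‖ ^ 2 ≤ (ε * 2 ^ (n + k)) ^ 2 := by
        refine (hsingle.trans hms).trans ?_
        rw [pow_add, h2k, mul_pow, hη, show (4 : ℝ) ^ n = (2 ^ n) ^ 2 by rw [← pow_mul, mul_comm, pow_mul]; norm_num]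
        have h0 : (0 : ℝ) ≤ ε ^ 2 * (2 ^ n) ^ 2 * (2 ^ (k - 1)) ^ 2 := by positivity
        nlinarith [h0]
      exact (pow_le_pow_iff_left₀ (norm_nonneg _) (by positivity) two_ne_zero).mp hB
  · exact hG n hn3 k (le_of_lt (lt_of_not_ge hk)) ψ

/-! ## §3 The stub as a FULL character mean square (no character removed) -/

/-- **`KMTVariance` ⇒ full character mean square**: for `k₀ ≤ k ≤ n`, `n ≥ n₀`,
`Σ_{ψ mod 2^k} |Σ_{m ≤ 2^(n+k)} λ(m) ψ(m)|² ≤ ε 4^(n+k)`.  With the KMT data at `ε/2`: the sum over `ψ ≠ χ` is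
`φ(2^k) V ≤ (ε/4) 4^(n+k)` (`variance_eq_charMeanSquare`), and the removed term `|Σ λχ|² ≤ (ε/2) 4^(n+k)` by the
dichotomy of `…KMTOnly.lean`. [folklore] -/
theorem charMeanSquareAll_of_kmtVariance (hK : KMTVariance) :
    ∀ ε : ℝ, 0 < ε → ∃ k₀ n₀ : ℕ, ∀ n ≥ n₀, ∀ k : ℕ, k₀ ≤ k → k ≤ n →
      ∑ ψ : DirichletCharacter ℂ (2 ^ k),
        ‖∑ m : Fin (2 ^ (n + k)), ((liouville ((m : ℕ) + 1) : ℤ) : ℂ) * ψ (((m : ℕ) + 1 : ℕ) : ZMod (2 ^ k))‖ ^ 2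
          ≤ ε * 4 ^ (n + k) := by
  intro ε hε
  set δ : ℝ := Real.sqrt (ε / 2) with hδ
  have hδ0 : 0 < δ := Real.sqrt_pos.mpr (by positivity)
  have hδsq : δ ^ 2 = ε / 2 := Real.sq_sqrt (by positivity)
  obtain ⟨k₀, n₁, hV⟩ := hK (ε / 2) (by positivity)
  obtain ⟨n₂, hR⟩ := twisted_le_of_sq_eq_one hδ0
  refine ⟨max k₀ 1, max n₁ n₂, fun n hn k hk hkn => ?_⟩
  have hk1 : 1 ≤ k := le_trans (le_max_right _ _) hk
  have hn1 : n₁ ≤ n := le_trans (le_max_left _ _) hn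
  have hn2 : n₂ ≤ n := le_trans (le_max_right _ _) hn
  obtain ⟨χ, hχ⟩ := hV n hn1 k (le_trans (le_max_left _ _) hk) hkn
  haveI : NeZero (2 ^ k) := ⟨pow_ne_zero _ two_ne_zero⟩
  -- the removed term
  have hT : ‖∑ m : Fin (2 ^ (n + k)), ((liouville ((m : ℕ) + 1) : ℤ) : ℂ) *
      χ (((m : ℕ) + 1 : ℕ) : ZMod (2 ^ k))‖ ≤ δ * 2 ^ (n + k) := by
    by_cases hsq : χ ^ 2 = 1
    · exact hR n hn2 k hk1 χ hsq
    · refine twisted_le_of_variance_of_sq_ne_one hk1 hδ0.le χ hsq ?_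
      rw [hδsq]
      exact hχ
  -- the other characters
  have hφ := totient_two_pow_cast hk1
  have hφ0 : (0 : ℝ) < Nat.totient (2 ^ k) := by rw [hφ]; positivity
  have hms := hχ
  rw [variance_eq_charMeanSquare n k hk1 χ, inv_mul_le_iff₀ hφ0, hφ] at hms
  rw [← Finset.add_sum_erase _ _ (Finset.mem_univ χ)]
  have h1 : ‖∑ m : Fin (2 ^ (n + k)), ((liouville ((m : ℕ) + 1) : ℤ) : ℂ) *
      χ (((m : ℕ) + 1 : ℕ) : ZMod (2 ^ k))‖ ^ 2 ≤ (δ * 2 ^ (n + k)) ^ 2 := pow_le_pow_left₀ (norm_nonneg _) hT 2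
  rw [mul_pow, hδsq] at h1
  have h2k : (2 : ℝ) ^ k = 2 * 2 ^ (k - 1) := by rw [← pow_succ', Nat.sub_add_cancel hk1]
  have h4 : (4 : ℝ) ^ n = (2 ^ n) ^ 2 := by rw [← pow_mul, mul_comm, pow_mul]; norm_num
  refine (add_le_add h1 hms).trans ?_
  rw [pow_add (4 : ℝ), h4, show (4 : ℝ) ^ k = (2 ^ k) ^ 2 by rw [← pow_mul, mul_comm, pow_mul]; norm_num,
    pow_add, h2k]
  have h0 : (0 : ℝ) ≤ ε * (2 ^ n) ^ 2 * (2 ^ (k - 1)) ^ 2 := by positivity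
  nlinarith [h0]

/-- **Full character mean square ⇒ `KMTVariance`** (with the trivial character as KMT character: dropping the
term `ψ = 1` only decreases the sum; `variance_eq_charMeanSquare`). [folklore] -/
theorem kmtVariance_of_charMeanSquareAll
    (h : ∀ ε : ℝ, 0 < ε → ∃ k₀ n₀ : ℕ, ∀ n ≥ n₀, ∀ k : ℕ, k₀ ≤ k → k ≤ n →
      ∑ ψ : DirichletCharacter ℂ (2 ^ k),
        ‖∑ m : Fin (2 ^ (n + k)), ((liouville ((m : ℕ) + 1) : ℤ) : ℂ) * ψ (((m : ℕ) + 1 : ℕ) : ZMod (2 ^ k))‖ ^ 2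
          ≤ ε * 4 ^ (n + k)) :
    KMTVariance := by
  intro ε hε
  obtain ⟨k₀, n₀, hS⟩ := h (ε / 2) (by positivity)
  refine ⟨max k₀ 1, n₀, fun n hn k hk hkn => ⟨1, ?_⟩⟩
  have hk1 : 1 ≤ k := le_trans (le_max_right _ _) hk
  haveI : NeZero (2 ^ k) := ⟨pow_ne_zero _ two_ne_zero⟩
  have hφ := totient_two_pow_cast hk1
  have hφ0 : (0 : ℝ) < Nat.totient (2 ^ k) := by rw [hφ]; positivity
  rw [variance_eq_charMeanSquare n k hk1 1, inv_mul_le_iff₀ hφ0, hφ]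
  refine (Finset.sum_le_sum_of_subset_of_nonneg (Finset.erase_subset _ _) fun _ _ _ => by positivity).trans ?_
  refine (hS n hn k (le_trans (le_max_left _ _) hk) hkn).trans (le_of_eq ?_)
  have h2k : (2 : ℝ) ^ k = 2 * 2 ^ (k - 1) := by rw [← pow_succ', Nat.sub_add_cancel hk1]
  rw [pow_add (4 : ℝ), show (4 : ℝ) ^ k = (2 ^ k) ^ 2 by rw [← pow_mul, mul_comm, pow_mul]; norm_num, h2k]
  ring

/-- **`KMTVariance` ⟺ the full character mean square** `Σ_{ψ mod 2^k} |Σ_{m ≤ 2^(n+k)} λ(m) ψ(m)|² ≤ ε 4^(n+k)`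
for `k₀ ≤ k ≤ n`, `n ≥ n₀` — for `λ` and `2`-power moduli the exceptional character of KMT Thm 1.3 can be dropped
(compare `charMeanSquare_of_kmtVariance` / `alignedTypeI_of_charMeanSquare` of `…Parseval.lean`, which keep it).
[folklore] -/
theorem kmtVariance_iff_charMeanSquareAll :
    KMTVariance ↔
      ∀ ε : ℝ, 0 < ε → ∃ k₀ n₀ : ℕ, ∀ n ≥ n₀, ∀ k : ℕ, k₀ ≤ k → k ≤ n →
        ∑ ψ : DirichletCharacter ℂ (2 ^ k),
          ‖∑ m : Fin (2 ^ (n + k)), ((liouville ((m : ℕ) + 1) : ℤ) : ℂ) * ψ (((m : ℕ) + 1 : ℕ) : ZMod (2 ^ k))‖ ^ 2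
            ≤ ε * 4 ^ (n + k) :=
  ⟨charMeanSquareAll_of_kmtVariance, kmtVariance_of_charMeanSquareAll⟩

end Summit.ValiantsHypothesis.ValiantsHypothesis.Theorems.LiouvilleSarnak.AlignedTypeI.CharactersModTwoN
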